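import Literature.AlgebraicGeometry.Modules.FrameTransition
import Literature.AlgebraicGeometry.Modules.SheafHomExact
import HarnessLib

/-!
# Modules with frames on a common cover and equal transition matrices are isomorphic

Let `M`, `N` be `𝒪_X`-modules on a scheme `X`, `(U_a)_{a ∈ ι}` an open cover of `X`, and
`e_a : 𝒪^{I_a} ≅ M|_{U_a}`, `f_a : 𝒪^{I_a} ≅ N|_{U_a}` frames on the SAME index types whose
transition matrices agree, `T(e_a, e_b) = T(f_a, f_b)` over every `U_a ∩ U_b`. Then the local
isomorphisms `M|_{U_a} ≅ N|_{U_a}`, `b^e_{a,k} ↦ b^f_{a,k}` (`frameComp`), agree on the overlaps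
(`restrictHom_frameComp_eq`) and glue (`Modules/SheafHom.lean`, `glueHom`) to an isomorphism
`isoOfFrames : M ≅ N` (Hartshorne II Ex. 5.18 (c): a locally free sheaf is determined up to
isomorphism by its transition data; Stacks Tag 00AK, uniqueness in glueing). Also recorded: the
passage from morphisms over `⊤` to morphisms of modules (`homOfTop`) is functorial
(`homOfTop_comp`, `homOfTop_id`). Everything is proved; no named facts.

## References

* R. Hartshorne, *Algebraic Geometry*, GTM 52 (1977), II Ex. 5.18. [Hartshorne1977]
* The Stacks Project, Tag 00AK. [StacksProject]
-/

noncomputable section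

open CategoryTheory AlgebraicGeometry Opposite TopologicalSpace Limits

namespace Literature.AlgebraicGeometry.Modules

open Literature.AlgebraicGeometry.Motives

universe u

variable {X : Scheme.{u}} {M N P : X.Modules}

/-! ### Morphisms over `⊤` -/

/-- The identification of `𝒪_X`-modules with their restrictions to the whole space: a morphism
`M|_⊤ → N|_⊤` gives `M ⟶ N` (values through `appLE`; the same construction as
`SerreTwist.homOfTop` of `Modules/SerreTwistHom.lean`, recorded here import-free). [folklore] -/
def homOfTop (ψ : M.over ⊤ ⟶ N.over ⊤) : M ⟶ N where
  val := PresheafOfModules.homMk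
    { app := fun U => AddCommGrpCat.ofHom
        { toFun := fun s => appLE ψ (homOfLE (le_top : U.unop ≤ ⊤)) s
          map_zero' := appLE_zero_right _ _
          map_add' := fun s s' => appLE_add_right _ _ s s' }
      naturality := fun {U V} g => by
        ext s
        change appLE ψ (homOfLE le_top) (M.presheaf.map g s) =
          N.presheaf.map g (appLE ψ (homOfLE le_top) s)
        have hg : g = (homOfLE g.unop.le).op := Subsingleton.elim _ _
        rw [hg, ← appLE_map]
        exact appLE_congr_hom _ _ _ _ }
    (fun U a s => appLE_smul_right ψ (homOfLE le_top) a s)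

/-- Values of `homOfTop`. [folklore] -/
@[simp]
theorem homOfTop_app (ψ : M.over ⊤ ⟶ N.over ⊤) (U : X.Opens) (s : Γ(M, U)) :
    (homOfTop ψ).app U s = appLE ψ (homOfLE (le_top : U ≤ ⊤)) s := rfl

/-- `homOfTop` is compatible with composition. [folklore] -/
lemma homOfTop_comp (ψ : M.over ⊤ ⟶ N.over ⊤) (ψ' : N.over ⊤ ⟶ P.over ⊤) :
    homOfTop (ψ ≫ ψ') = homOfTop ψ ≫ homOfTop ψ' := by
  refine Scheme.Modules.hom_ext _ _ fun U => ?_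
  ext s
  rw [Scheme.Modules.Hom.comp_app, CategoryTheory.comp_apply, homOfTop_app, homOfTop_app,
    homOfTop_app, appLE_comp]

/-- `homOfTop 𝟙 = 𝟙`. [folklore] -/
lemma homOfTop_id : homOfTop (𝟙 (M.over ⊤)) = 𝟙 M := by
  refine Scheme.Modules.hom_ext _ _ fun U => ?_
  ext s
  rw [homOfTop_app, appLE_id]
  rfl

/-! ### The local comparison morphisms -/

section Local

variable {W : X.Opens} {I : Type u} (e : SheafOfModules.free I ≅ M.over W)
  (f : SheafOfModules.free I ≅ N.over W)

/-- The morphism `M|_W → N|_W` sending the basis sections of the frame `e` to those of `f`.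
[folklore] -/
def frameComp : M.over W ⟶ N.over W :=
  homOfBasisValues e (basisSection f)

/-- `frameComp e f` sends `b^e_k` to `b^f_k`. [folklore] -/
@[simp]
lemma appLE_frameComp_basisSection (k : I) :
    appLE (frameComp e f) (𝟙 W) (basisSection e k) = basisSection f k :=
  appLE_homOfBasisValues e _ k

/-- `frameComp e f ≫ frameComp f e = 𝟙`. [folklore] -/
lemma frameComp_comp_frameComp : frameComp e f ≫ frameComp f e = 𝟙 _ :=
  hom_ext_of_basisSection e fun k => by
    rw [appLE_comp, appLE_frameComp_basisSection, appLE_frameComp_basisSection, appLE_id]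

/-- `frameComp e f` on restricted basis sections, over `V ≤ W`. [folklore] -/
lemma appLE_frameComp_map_basisSection {V : X.Opens} (k : V ⟶ W) (l : I) :
    appLE (frameComp e f) k (M.presheaf.map k.op (basisSection e l)) =
      N.presheaf.map k.op (basisSection f l) := by
  rw [appLE_congr_hom (frameComp e f) k (k ≫ 𝟙 W), appLE_map, appLE_frameComp_basisSection]

end Local

/-! ### Compatibility on overlaps and gluing -/

section Glue

variable {ι : Type u} (U : ι → X.Opens) {I : ι → Type u} [∀ a, Fintype (I a)]
  (e : ∀ a, SheafOfModules.free (I a) ≅ M.over (U a))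
  (f : ∀ a, SheafOfModules.free (I a) ≅ N.over (U a))
  (hT : ∀ a b, transition (e a) (e b) (Opens.infLELeft (U a) (U b)) (Opens.infLERight (U a) (U b)) =
    transition (f a) (f b) (Opens.infLELeft (U a) (U b)) (Opens.infLERight (U a) (U b)))

include hT in
/-- **Equal transition matrices make the local comparison morphisms agree on overlaps.**
[cite: Hartshorne1977, II Ex. 5.18] -/
theorem restrictHom_frameComp_eq (a b : ι) :
    restrictHom (Opens.infLELeft (U a) (U b)) (frameComp (e a) (f a)) =
      restrictHom (Opens.infLERight (U a) (U b)) (frameComp (e b) (f b)) := by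
  refine hom_ext_of_basisSection
    (SheafOfModules.restrictTrivialisation (R := X.ringCatSheaf) (Opens.infLERight (U a) (U b)) (e b))
    fun l => ?_
  rw [basisSection_restrictTrivialisation, appLE_restrictHom, appLE_restrictHom, Category.id_comp,
    Category.id_comp, appLE_frameComp_map_basisSection,
    map_basisSection_eq_sum_transition (e a) (e b) (Opens.infLELeft (U a) (U b))
      (Opens.infLERight (U a) (U b)) l,
    map_basisSection_eq_sum_transition (f a) (f b) (Opens.infLELeft (U a) (U b))
      (Opens.infLERight (U a) (U b)) l,
    appLE_sum_right, hT a b]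
  refine Finset.sum_congr rfl fun m _ => ?_
  rw [appLE_smul_right, appLE_frameComp_map_basisSection]

/-- The glued comparison morphism `M|_{⨆ U_a} → N|_{⨆ U_a}`. [folklore] -/
def gluedComp : M.over (iSup U) ⟶ N.over (iSup U) :=
  glueHom U (fun a => frameComp (e a) (f a)) (restrictHom_frameComp_eq U e f hT)

/-- The glued comparison morphism restricts to the local ones. [folklore] -/
lemma restrictHom_gluedComp (a : ι) :
    restrictHom (Opens.leSupr U a) (gluedComp U e f hT) = frameComp (e a) (f a) :=
  restrictHom_glueHom U _ _ a

/-- The two glued comparison morphisms are inverse to each other. [folklore] -/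
lemma gluedComp_comp_gluedComp :
    gluedComp U e f hT ≫ gluedComp U f e (fun a b => (hT a b).symm) = 𝟙 _ := by
  have h1 : ∀ a b, restrictHom (Opens.infLELeft (U a) (U b)) (𝟙 (M.over (U a))) =
      restrictHom (Opens.infLERight (U a) (U b)) (𝟙 (M.over (U b))) := fun a b => by
    rw [restrictHom_id, restrictHom_id]
  rw [eq_glueHom U (fun a => 𝟙 (M.over (U a))) h1 (gluedComp U e f hT ≫ gluedComp U f e _) fun a => by
      rw [restrictHom_comp, restrictHom_gluedComp, restrictHom_gluedComp, frameComp_comp_frameComp],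
    ← eq_glueHom U (fun a => 𝟙 (M.over (U a))) h1 (𝟙 _) fun a => restrictHom_id _]

variable (hU : iSup U = ⊤)

/-- The glued comparison morphism over the whole space. [folklore] -/
def gluedCompTop : M.over ⊤ ⟶ N.over ⊤ :=
  restrictHom (homOfLE hU.ge) (gluedComp U e f hT)

/-- The comparison morphisms over `⊤` are inverse to each other. [folklore] -/
lemma gluedCompTop_comp_gluedCompTop :
    gluedCompTop U e f hT hU ≫ gluedCompTop U f e (fun a b => (hT a b).symm) hU = 𝟙 _ := by
  rw [gluedCompTop, gluedCompTop, ← restrictHom_comp, gluedComp_comp_gluedComp, restrictHom_id]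

/-- **Modules with frames on a common open cover and equal transition matrices are isomorphic**
(Hartshorne II Ex. 5.18 (c): the locally free sheaf with given transition data is unique up to
isomorphism). [cite: Hartshorne1977, II Ex. 5.18] -/
def isoOfFrames : M ≅ N where
  hom := homOfTop (gluedCompTop U e f hT hU)
  inv := homOfTop (gluedCompTop U f e (fun a b => (hT a b).symm) hU)
  hom_inv_id := by rw [← homOfTop_comp, gluedCompTop_comp_gluedCompTop, homOfTop_id]
  inv_hom_id := by rw [← homOfTop_comp, gluedCompTop_comp_gluedCompTop, homOfTop_id]

/-- **`isoOfFrames` sends the basis sections of `e_a` to those of `f_a`.** [folklore] -/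
theorem isoOfFrames_hom_app_basisSection (a : ι) (k : I a) :
    (isoOfFrames U e f hT hU).hom.app (U a) (basisSection (e a) k) = basisSection (f a) k := by
  change appLE (gluedCompTop U e f hT hU) (homOfLE le_top) (basisSection (e a) k) = _
  rw [gluedCompTop, appLE_restrictHom,
    Subsingleton.elim (homOfLE (le_top : U a ≤ ⊤) ≫ homOfLE hU.ge) (𝟙 (U a) ≫ Opens.leSupr U a),
    ← appLE_restrictHom, restrictHom_gluedComp, appLE_frameComp_basisSection]

/-- Values of `isoOfFrames` on sections over an open inside some `U_a`: those of the local
comparison `frameComp (e a) (f a)`. [folklore] -/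
theorem isoOfFrames_hom_app {V : X.Opens} (a : ι) (k : V ⟶ U a) (s : Γ(M, V)) :
    (isoOfFrames U e f hT hU).hom.app V s = appLE (frameComp (e a) (f a)) k s := by
  change appLE (gluedCompTop U e f hT hU) (homOfLE le_top) s = _
  rw [gluedCompTop, appLE_restrictHom,
    Subsingleton.elim (homOfLE (le_top : V ≤ ⊤) ≫ homOfLE hU.ge) (k ≫ Opens.leSupr U a),
    ← appLE_restrictHom, restrictHom_gluedComp]

end Glue

end Literature.AlgebraicGeometry.Modules

end
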